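import Literature.Computability.Complexity.LengthCompare
import Literature.Computability.Complexity.StringSwap
import HarnessLib

/-!
# The string-equality test `⟨a, b⟩ ↦ [a = b]` is polynomial time (trunk CplxCore)

Machine-level infrastructure for certificate verifiers that must *compare* two strings — e.g.
the `NP`-verifier of Liu–Pass's `MK^tP[s]` (`CryptoFoundationsKolmogorovProofs.lean`: "run
the universal machine on the guessed program and compare its output with `x`"), or any
verifier of the shape "recompute and compare". Equality of the two components of a pair-coded
string `⟨a, b⟩ = boolPair a b` is not a finite-state property, so — exactly as for the length
test of `LengthCompare.lean` — the test is assembled from the tree's `FinTM2` toolkit without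
programming a new machine: the unary clock `initFn : ⟨a, b⟩ ↦ 1^{|a|} 0 0 ⟨a, b⟩`
(`UnaryArithMachines.lean`), a recoding transducer `eqInit` (clock block to `none`s, payload
`⟨a, b⟩` verbatim), `|a|` clocked rounds (`PolyTimeComputable.iterate_of_le_add`,
`TM2Iterate.lean`) of the transducer `eqStep`, which strips the first symbol of each component
if they agree and otherwise collapses the word to the junk pair `failWord = 10`, and the final
recogniser `eqOut` of the word `01 = ⟨[], []⟩`.

* `eqPairFn ∈ FP`, `eqPairFn ⟨a, b⟩ = [decide (a = b)]` (`eqPairFn_boolPair`), and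
  `eqPairFn w ∈ {[1], [0]}` on every input (`eqPairFn_eq_or`);
* `EqPair = {w | eqPairFn w = [1]} ∈ P` with `⟨a, b⟩ ∈ EqPair ↔ a = b`;
* the fan-out combinator `fanoutFn f g = (z ↦ ⟨f z, g z⟩)` (`copyFn`, `mapFstFn`, `mapSndFn`), in
  `FP` for `f, g ∈ FP` (`fanoutFn_mem_FP`), and the corollary used by "recompute and compare"
  verifiers and coin predicates: `{z | f z = g z} ∈ P` for `f, g ∈ FP`
  (`setOf_apply_eq_apply_mem_P`, the preimage of `EqPair` under the fan-out).

## References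

* S. Arora, B. Barak, *Computational Complexity: A Modern Approach*, CUP 2009, §1.3 (multi-tape
  machine constructions; "basic" string manipulation is polynomial time), §1.4.1 (clocked
  simulation), Def. 2.1 (certificate verifiers).
* J. E. Hopcroft, J. D. Ullman, *Introduction to Automata Theory, Languages, and Computation*,
  1979, §2.7 (Mealy machines).
-/

namespace Literature.Computability.Complexity

open _root_.Computability StrCopy

namespace StrEq

/-! ### Pair-coded words -/

/-- `⟨c a, b⟩ = c c ⟨a, b⟩` (local copy of `CoinTrunc.boolPair_cons` /
`CryptoQuantFine.boolPair_cons`, neither of which is importable here without inverting the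
toolkit layering; canonical home: `BoolEncodings.lean` next to `boolPair`). [Arora–Barak 2009,
§0.1] [cite: AroraBarakCC2009, §0.1] -/
theorem boolPair_cons_left (c : Bool) (a b : List Bool) :
    boolPair (c :: a) b = c :: c :: boolPair a b := by
  simp [boolPair]

/-- The junk pair `10`: the absorbing "not equal" word of the step transducer (it is not of the
form `⟨a, b⟩`, and `boolUnpair` reads it as `([], [])`). [folklore] -/
def failWord : List Bool := [true, false]

/-! ### Stage 2: `eqInit` -/

/-- States of `eqInit`: clock block, (empty) second block, payload. [folklore] -/
inductive S₂
  | cnt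
  | z1
  | body
  deriving DecidableEq, Fintype

/-- Transition of `eqInit`: the clock `1ⁿ` becomes `noneⁿ`, the second unary block is dropped,
the payload is copied as data symbols. [folklore] -/
def eqInitStep : S₂ → Bool → S₂ × List (Option Bool)
  | .cnt, true => (.cnt, [none])
  | .cnt, false => (.z1, [])
  | .z1, true => (.z1, [])
  | .z1, false => (.body, [])
  | .body, c => (.body, [some c])

/-- The recoding transducer `1ⁿ 0 1ᵃ 0 z ↦ noneⁿ ++ z.map some`. [folklore] -/
def eqInit : FST S₂ Bool (Option Bool) where
  init := .cnt
  step := eqInitStep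
  front := fun _ => []
  keep := fun _ => true

/-- The transition of `eqInit` (definitional). [folklore] -/
@[simp] theorem eqInit_step (s : S₂) (b : Bool) : eqInit.step s b = eqInitStep s b := rfl

/-- Payload/count decomposition of the output of `eqInit` on an arbitrary input. [folklore] -/
def stage2 (w : List Bool) : List Bool × ℕ :=
  ((splitOnes (splitOnes w).2).2, (splitOnes w).1)

/-- From `body` the input is copied as data symbols. [folklore] -/
theorem eqInit_run_body (w : List Bool) : (eqInit.run .body w).2 = w.map some := by
  induction w with
  | nil => rfl
  | cons b w ih => simp [FST.run_cons, eqInitStep, ih]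

/-- From `z1`: skip the unary block, then copy. [folklore] -/
theorem eqInit_run_z1 (w : List Bool) : (eqInit.run .z1 w).2 = ((splitOnes w).2).map some := by
  induction w with
  | nil => rfl
  | cons b w ih =>
    cases b
    · simp [FST.run_cons, eqInitStep, splitOnes, eqInit_run_body]
    · simp [FST.run_cons, eqInitStep, splitOnes, ih]

/-- From `cnt`: the clock as `none`s, then the rest. [folklore] -/
theorem eqInit_run_cnt (w : List Bool) :
    (eqInit.run .cnt w).2 =
      List.replicate (splitOnes w).1 none ++ ((splitOnes (splitOnes w).2).2).map some := by
  induction w with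
  | nil => rfl
  | cons b w ih =>
    cases b
    · simp [FST.run_cons, eqInitStep, splitOnes, eqInit_run_z1]
    · simp [FST.run_cons, eqInitStep, splitOnes, ih, List.replicate_succ]

/-- **Shape of the output of `eqInit` on every input.** [folklore] -/
theorem eqInit_eval (w : List Bool) :
    eqInit.eval w = List.replicate (stage2 w).2 none ++ ((stage2 w).1).map some := by
  have he : eqInit.eval w = (eqInit.run .cnt w).2 := by simp [FST.eval, eqInit]
  rw [he, eqInit_run_cnt, stage2]

/-- On `1ⁿ 0 1ᵃ 0 z` the decomposition is `(z, n)`. [folklore] -/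
@[simp] theorem stage2_hdr (n a : ℕ) (z : List Bool) : stage2 (hdr n a z) = (z, n) := by
  simp [stage2, hdr]

/-- `stage2` is polynomial-time computable into the input encoding of the iteration combinator.
[folklore] -/
theorem polyTimeComputable_stage2 :
    PolyTimeComputable (id : List Bool → List Bool)
      (fun q : List Bool × ℕ => List.replicate q.2 none ++ (id q.1).map some) stage2 := by
  obtain ⟨p, M, hM⟩ := eqInit.polyTimeComputable_eval
  refine ⟨p, M, fun w => ?_⟩
  have h := hM w
  simp only [id, eqInit_eval] at h ⊢
  exact h

/-! ### Stage 3: one comparison round, `eqStep` -/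

/-- States of `eqStep`: `a0`/`a1 c` read the first pair of the word; `cp c`/`cp1 c e` copy the
remaining doubled symbols of the first component, remembering its first symbol `c`; `chk c`
compares `c` with the first symbol of the second component; `copy` copies the rest; `fail` is
absorbing. [folklore] -/
inductive S₃
  | a0
  | a1 (c : Bool)
  | cp (c : Bool)
  | cp1 (c e : Bool)
  | chk (c : Bool)
  | copy
  | fail
  deriving DecidableEq, Fintype

/-- Transition of `eqStep`. On `⟨c a', d b'⟩ = c c (dup a') 0 1 d b'`: drop the pair `c c`,
copy `dup a'`, at the separator compare `d` with `c` and, if equal, emit `0 1` and copy `b'`;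
any mismatch or malformed pair leads to `fail`; a word starting with the separator (`a = []`)
is copied unchanged. [folklore] -/
def eqStepStep : S₃ → Bool → S₃ × List Bool
  | .a0, c => (.a1 c, [])
  | .a1 c, c' =>
    if c' = c then (.cp c, []) else if c' = true then (.copy, [false, true]) else (.fail, [])
  | .cp c, e => (.cp1 c e, [])
  | .cp1 c e, e' =>
    if e' = e then (.cp c, [e, e]) else if e' = true then (.chk c, []) else (.fail, [])
  | .chk c, d => if d = c then (.copy, [false, true]) else (.fail, [])
  | .copy, d => (.copy, [d])
  | .fail, _ => (.fail, [])

/-- The rejecting final states of `eqStep`: `fail`, and `chk c` (the second component ran out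
while the first did not). [folklore] -/
def S₃.bad : S₃ → Bool
  | .fail => true
  | .chk _ => true
  | _ => false

/-- One comparison round (see `eqStep_eval_cons_cons`): in a rejecting final state the body is
discarded and the junk pair `failWord` is output instead. [folklore] -/
def eqStep : FST S₃ Bool Bool where
  init := .a0
  step := eqStepStep
  front := fun s => if s.bad then failWord else []
  keep := fun s => !s.bad

/-- The transition of `eqStep` (definitional). [folklore] -/
@[simp] theorem eqStep_step (s : S₃) (b : Bool) : eqStep.step s b = eqStepStep s b := rfl

/-- The initial state of `eqStep` (definitional). [folklore] -/
@[simp] theorem eqStep_init : eqStep.init = .a0 := rfl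

/-- The final word of `eqStep` (definitional). [folklore] -/
@[simp] theorem eqStep_front (s : S₃) : eqStep.front s = if s.bad then failWord else [] := rfl

/-- The keep flag of `eqStep` (definitional). [folklore] -/
@[simp] theorem eqStep_keep (s : S₃) : eqStep.keep s = !s.bad := rfl

/-- The copier of `eqStep`. [folklore] -/
theorem eqStep_run_copy (w : List Bool) : eqStep.run .copy w = (.copy, w) := by
  induction w with
  | nil => rfl
  | cons b w ih => simp [FST.run_cons, eqStepStep, ih]

/-- The absorbing state of `eqStep`. [folklore] -/
theorem eqStep_run_fail (w : List Bool) : eqStep.run .fail w = (.fail, []) := by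
  induction w with
  | nil => rfl
  | cons b w ih => simp [FST.run_cons, eqStepStep, ih]

/-- From `cp c` the doubled symbols are copied up to the separator, after which the run continues
in `chk c`. [folklore] -/
theorem eqStep_run_cp (c : Bool) (a' r : List Bool) :
    eqStep.run (.cp c) (dup a' ++ false :: true :: r) =
      ((eqStep.run (.chk c) r).1, dup a' ++ (eqStep.run (.chk c) r).2) := by
  induction a' with
  | nil => simp [dup, FST.run_cons, eqStepStep]
  | cons e a' ih =>
    have h1 : eqStep.run (.cp c) (e :: e :: (dup a' ++ false :: true :: r)) =
        ((eqStep.run (.cp c) (dup a' ++ false :: true :: r)).1,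
          e :: e :: (eqStep.run (.cp c) (dup a' ++ false :: true :: r)).2) := by
      simp [FST.run_cons, eqStepStep]
    rw [show dup (e :: a') = e :: e :: dup a' by simp [dup], List.cons_append, List.cons_append,
      h1, ih]
    simp

/-- **One round on `⟨c a', d b'⟩`**: strip `c` and `d` if they agree, otherwise fail.
[folklore] -/
theorem eqStep_eval_cons_cons (c d : Bool) (a' b' : List Bool) :
    eqStep.eval (boolPair (c :: a') (d :: b')) = if c = d then boolPair a' b' else failWord := by
  rw [boolPair_cons_left, boolPair_eq_dup]
  by_cases h : c = d
  · subst h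
    simp [FST.eval, FST.run_cons, eqStepStep, eqStep_run_cp, eqStep_run_copy, S₃.bad,
      boolPair_eq_dup]
  · have hd : d ≠ c := fun e => h e.symm
    simp [FST.eval, FST.run_cons, eqStepStep, eqStep_run_cp, eqStep_run_fail, S₃.bad, h, hd]

/-- One round on `⟨c a', []⟩`: the second component is exhausted first — fail. [folklore] -/
theorem eqStep_eval_cons_nil (c : Bool) (a' : List Bool) :
    eqStep.eval (boolPair (c :: a') []) = failWord := by
  rw [boolPair_cons_left, boolPair_eq_dup]
  simp [FST.eval, FST.run_cons, eqStepStep, eqStep_run_cp, S₃.bad]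

/-- One round on `⟨[], b⟩`: nothing to compare, the word is unchanged. [folklore] -/
theorem eqStep_eval_nil_left (b : List Bool) : eqStep.eval (boolPair [] b) = boolPair [] b := by
  rw [boolPair_eq_dup]
  simp [dup, FST.eval, FST.run_cons, eqStepStep, eqStep_run_copy, S₃.bad]

/-- The junk pair is a fixed point of `eqStep`. [folklore] -/
@[simp] theorem eqStep_eval_failWord : eqStep.eval failWord = failWord := by
  simp [failWord, FST.eval, FST.run_cons, eqStepStep, S₃.bad]

/-- … hence of all its iterates. [folklore] -/
@[simp] theorem eqStep_iterate_failWord (k : ℕ) : eqStep.eval^[k] failWord = failWord := by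
  induction k with
  | zero => rfl
  | succ k ih => rw [Function.iterate_succ_apply, eqStep_eval_failWord, ih]

/-- **`k ≤ |a|` rounds on `⟨a, b⟩`** compare the first `k` symbols: the result is
`⟨a.drop k, b.drop k⟩` if `a.take k = b.take k` and `failWord` otherwise. [folklore] -/
theorem eqStep_iterate_boolPair (k : ℕ) : ∀ a b : List Bool, k ≤ a.length →
    eqStep.eval^[k] (boolPair a b) =
      if a.take k = b.take k then boolPair (a.drop k) (b.drop k) else failWord := by
  induction k with
  | zero => intro a b _; simp
  | succ k ih =>
    intro a b hk
    cases a with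
    | nil => simp at hk
    | cons c a' =>
      rw [Function.iterate_succ_apply]
      cases b with
      | nil => simp [eqStep_eval_cons_nil]
      | cons d b' =>
        rw [eqStep_eval_cons_cons]
        by_cases hcd : c = d
        · subst hcd
          rw [if_pos rfl, ih a' b' (by simpa using hk)]
          simp
        · have hne : (c :: a').take (k + 1) ≠ (d :: b').take (k + 1) := by simp [hcd]
          rw [if_neg hcd, eqStep_iterate_failWord, if_neg hne]

/-- **After `|a|` rounds the word is `0 1 = ⟨[], []⟩` iff `a = b`.** [folklore] -/
theorem eqStep_iterate_eq_iff (a b : List Bool) :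
    eqStep.eval^[a.length] (boolPair a b) = [false, true] ↔ a = b := by
  rw [eqStep_iterate_boolPair a.length a b le_rfl, List.take_length, List.drop_length]
  constructor
  · intro h
    by_cases hab : a = b.take a.length
    · rw [if_pos hab, boolPair_eq_dup] at h
      simp only [dup, List.flatMap_nil, List.nil_append, List.cons.injEq, true_and,
        List.drop_eq_nil_iff] at h
      rw [hab, List.take_of_length_le h]
    · rw [if_neg hab] at h
      simp [failWord] at h
  · rintro rfl
    simp [boolPair_eq_dup, dup]

/-- Potential bounding the output excess of `eqStep` from each state. [folklore] -/
def S₃.pot : S₃ → ℕ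
  | .a1 _ => 1
  | .cp1 _ _ => 1
  | .chk _ => 1
  | _ => 0

/-- Each transition of `eqStep` emits at most one symbol plus the potential drop. [folklore] -/
theorem eqStepStep_length_le (s : S₃) (b : Bool) :
    (eqStepStep s b).2.length + (eqStepStep s b).1.pot ≤ 1 + s.pot := by
  rcases s with _ | c | c | ⟨c, e⟩ | c | _ | _ <;> cases b <;> (try cases c) <;> (try cases e) <;>
    simp [eqStepStep, S₃.pot]

/-- The body emitted by `eqStep` from state `s` has length `≤ |w| + pot s`. [folklore] -/
theorem eqStep_length_run_le (w : List Bool) :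
    ∀ s : S₃, (eqStep.run s w).2.length ≤ w.length + s.pot := by
  induction w with
  | nil => intro s; simp
  | cons b w ih =>
    intro s
    have h₁ := eqStepStep_length_le s b
    have h₂ := ih (eqStepStep s b).1
    simp only [FST.run_cons, eqStep_step, List.length_append, List.length_cons]
    omega

/-- `|eqStep w| ≤ |w| + 2`. [folklore] -/
theorem length_eqStep_eval_le (w : List Bool) : (eqStep.eval w).length ≤ w.length + 2 := by
  have h := eqStep_length_run_le w .a0
  simp only [S₃.pot, Nat.add_zero] at h
  simp only [FST.eval, eqStep_init, eqStep_front, eqStep_keep]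
  cases (eqStep.run S₃.a0 w).1.bad
  · simp only [Bool.false_eq_true, ↓reduceIte, Bool.not_false, List.nil_append]
    omega
  · simp [failWord]

/-- **Clocked comparison rounds are polynomial time.** [Arora–Barak 2009, §1.4.1]
[cite: AroraBarakCC2009, §1.4.1] -/
theorem polyTimeComputable_iterate_eqStep :
    PolyTimeComputable (fun q : List Bool × ℕ => List.replicate q.2 none ++ (id q.1).map some)
      (id : List Bool → List Bool) (fun q => eqStep.eval^[q.2] q.1) :=
  PolyTimeComputable.iterate_of_le_add (ea := (id : List Bool → List Bool)) 2
    (fun w => by simpa using length_eqStep_eval_le w) eqStep.polyTimeComputable_eval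

/-! ### Stage 4: recognising `0 1`, `eqOut` -/

/-- States of `eqOut`: the prefix of `0 1` read so far, or failure. [folklore] -/
inductive S₄
  | s0
  | s1
  | s2
  | bad
  deriving DecidableEq, Fintype

/-- Transition of `eqOut`. [folklore] -/
def eqOutStep : S₄ → Bool → S₄ × List Bool
  | .s0, false => (.s1, [])
  | .s0, true => (.bad, [])
  | .s1, true => (.s2, [])
  | .s1, false => (.bad, [])
  | .s2, _ => (.bad, [])
  | .bad, _ => (.bad, [])

/-- The recogniser of the single word `0 1`: verdict `[1]` iff the input is `[false, true]`.
[folklore] -/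
def eqOut : FST S₄ Bool Bool where
  init := .s0
  step := eqOutStep
  front := fun s => [decide (s = .s2)]
  keep := fun _ => false

/-- The transition of `eqOut` (definitional). [folklore] -/
@[simp] theorem eqOut_step (s : S₄) (b : Bool) : eqOut.step s b = eqOutStep s b := rfl

/-- `bad` is absorbing. [folklore] -/
theorem eqOut_run_bad (w : List Bool) : (eqOut.run .bad w).1 = .bad := by
  induction w with
  | nil => rfl
  | cons b w ih => simpa [FST.run_cons, eqOutStep] using ih

/-- `eqOut` ends in `s2` exactly on the word `0 1`. [folklore] -/
theorem eqOut_run_eq_iff (w : List Bool) : (eqOut.run .s0 w).1 = .s2 ↔ w = [false, true] := by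
  match w with
  | [] => simp
  | [b] => cases b <;> simp [FST.run_cons, eqOutStep]
  | b :: b' :: rest =>
    cases b <;> cases b' <;> cases rest <;> simp [FST.run_cons, eqOutStep, eqOut_run_bad]

/-- `eqOut w = [decide (w = 0 1)]`. [folklore] -/
theorem eqOut_eval (w : List Bool) : eqOut.eval w = [decide (w = [false, true])] := by
  have h : eqOut.eval w = [decide ((eqOut.run .s0 w).1 = .s2)] := by simp [FST.eval, eqOut]
  rw [h, Bool.decide_congr (eqOut_run_eq_iff w)]

end StrEq

open StrEq

/-! ### The equality test -/

/-- **The string-equality test** `eqPairFn`, a total string function with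
`eqPairFn ⟨a, b⟩ = [decide (a = b)]` (`eqPairFn_boolPair`): clock `|a|`, recode, `|a|`
comparison rounds, recognise `⟨[], []⟩`. [Arora–Barak 2009, §1.3] [cite: AroraBarakCC2009, §1.3] -/
def eqPairFn : List Bool → List Bool :=
  eqOut.eval ∘ (fun s : List Bool × ℕ => eqStep.eval^[s.2] s.1) ∘ StrEq.stage2 ∘ initFn

/-- **`eqPairFn ⟨a, b⟩ = [decide (a = b)]`.** [Arora–Barak 2009, §1.3] [cite: AroraBarakCC2009, §1.3] -/
theorem eqPairFn_boolPair (a b : List Bool) : eqPairFn (boolPair a b) = [decide (a = b)] := by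
  simp only [eqPairFn, Function.comp_apply, initFn, boolUnpair_boolPair, StrEq.stage2_hdr,
    eqOut_eval]
  rw [Bool.decide_congr (eqStep_iterate_eq_iff a b)]

/-- The equality test always answers `[1]` or `[0]`. [folklore] -/
theorem eqPairFn_eq_or (w : List Bool) : eqPairFn w = [true] ∨ eqPairFn w = [false] := by
  simp only [eqPairFn, Function.comp_apply, eqOut_eval]
  by_cases h : eqStep.eval^[(StrEq.stage2 (initFn w)).2] (StrEq.stage2 (initFn w)).1 = [false, true]
    <;> simp [h]

/-- **The equality test is in `FP`** (composition of the four polynomial-time stages).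
[Arora–Barak 2009, §1.3, Thm. 2.8 (proof: composition)] [cite: AroraBarakCC2009, §1.3] -/
theorem eqPairFn_mem_FP : eqPairFn ∈ FP :=
  PolyTimeComputable.comp_holds eqOut.polyTimeComputable_eval
    (PolyTimeComputable.comp_holds polyTimeComputable_iterate_eqStep
      (PolyTimeComputable.comp_holds StrEq.polyTimeComputable_stage2 initFn_mem_FP))

/-- **The equality language** `EqPair = {w | eqPairFn w = [1]}`; on pairs,
`⟨a, b⟩ ∈ EqPair ↔ a = b`. [Arora–Barak 2009, §1.3] [cite: AroraBarakCC2009, §1.3] -/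
def EqPair : Language Bool :=
  {w | eqPairFn w = [true]}

/-- Membership of a pair in `EqPair`. [folklore] -/
@[simp] theorem boolPair_mem_EqPair (a b : List Bool) : boolPair a b ∈ EqPair ↔ a = b := by
  change eqPairFn (boolPair a b) = [true] ↔ _
  rw [eqPairFn_boolPair]
  simp

/-- **`EqPair ∈ P`.** [Arora–Barak 2009, §1.3, Def. 1.13] [cite: AroraBarakCC2009, §1.3] -/
theorem EqPair_mem_P : EqPair ∈ Classes.P :=
  mem_P_of_mem_FP eqPairFn_mem_FP _ fun w =>
    ⟨fun h => h, fun h => (eqPairFn_eq_or w).resolve_left h⟩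

/-! ### Fan-out and equality tests of polynomial-time maps -/

/-- **Fan-out** `z ↦ ⟨f z, g z⟩`: copy the input, apply `f` to the first copy and `g` to the
second (`mapSndFn g ∘ mapFstFn f ∘ copyFn`). [Arora–Barak 2009, §1.3] [cite: AroraBarakCC2009, §1.3] -/
noncomputable def fanoutFn (f g : List Bool → List Bool) : List Bool → List Bool :=
  mapSndFn g ∘ mapFstFn f ∘ copyFn

/-- `fanoutFn f g z = ⟨f z, g z⟩`. [folklore] -/
@[simp] theorem fanoutFn_apply (f g : List Bool → List Bool) (z : List Bool) :
    fanoutFn f g z = boolPair (f z) (g z) := by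
  simp [fanoutFn, copyFn_apply]

/-- `fanoutFn f g ∈ FP` for `f, g ∈ FP`. [Arora–Barak 2009, Thm. 2.8 (proof: composition)] [cite: AroraBarakCC2009, §1.3] -/
theorem fanoutFn_mem_FP {f g : List Bool → List Bool} (hf : f ∈ FP) (hg : g ∈ FP) :
    fanoutFn f g ∈ FP :=
  comp_mem_FP (mapSndFn_mem_FP hg) (comp_mem_FP (mapFstFn_mem_FP hf) copyFn_mem_FP)

/-- **Equality tests of polynomial-time maps are in `P`**: for `f, g ∈ FP` the language
`{z | f z = g z}` is in `P` — it is the preimage of `EqPair` under the fan-out `z ↦ ⟨f z, g z⟩`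
(`preimage_mem_P`). [Arora–Barak 2009, §1.3, Thm. 2.8] [cite: AroraBarakCC2009, §1.3] -/
theorem setOf_apply_eq_apply_mem_P {f g : List Bool → List Bool} (hf : f ∈ FP) (hg : g ∈ FP) :
    ({z | f z = g z} : Language Bool) ∈ Classes.P := by
  have h : ({z | f z = g z} : Language Bool) = fanoutFn f g ⁻¹' EqPair := by
    ext z
    change f z = g z ↔ fanoutFn f g z ∈ EqPair
    rw [fanoutFn_apply, boolPair_mem_EqPair]
  rw [h]
  exact preimage_mem_P EqPair_mem_P (fanoutFn_mem_FP hf hg)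

end Literature.Computability.Complexity
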